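import Summits.AtomisticToContinuum.HydrodynamicLimit.Theorems.CollisionIsometryCLTMacroClosureTwoScaleDefs
import Summits.AtomisticToContinuum.HydrodynamicLimit.Theorems.CollisionIsometryCLTMacroClosureStubClausiusTotals
import Summits.AtomisticToContinuum.HydrodynamicLimit.Theses.StiffCollisionalRelaxation
import HarnessLib

/-!
# Pointwise Jensen inequality for the box-smoothed block (input of `stub_blockMGF_twoScale`,
line `IdeatorTwoGen1Sketch`, crux `MacroClosure`, stmt-AtomisticToContinuum-14870)

Proof file (`--supports stmt-AtomisticToContinuum-14870`) for the registered stub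
`Barycentric.stub_twoScale_jensenPoint`: for the box kernel `b = boxKernel ℓ` mollified by the torus
mollifier `ψ = Torus.kernel δ`, the positive part of the Bregman density of the block state against a
homogeneous state is dominated by the `ψ`-average of the positive parts of the Bregman densities of the
shifted box blocks, `h⁺(Ū_{b⋆ψ}(z,x) | U_c) ≤ ∫ ψ(w) h⁺(Ū_b(z,x+w) | U_c) dw`.

Finite-range Jensen (no closedness / continuity of `η_σ` needed):
* `JensenPoint.bU_conv_eq_integral` — `Ū_{b⋆ψ}(z,x) = ∫ ψ(w) • Ū_b(z,x+w) dw` (Haar invariance via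
  `Torus.convolution_comm_real`, Fubini over the finite empirical sum);
* `JensenPoint.bU_boxKernel` — `w ↦ Ū_b(z,x+w)` factors through the cell index set
  `S(w) = cellSet ℓ z (x+w)` (finitely many values, measurable level sets
  `JensenPoint.measurableSet_cellSet_eq`), so both integrals are finite convex combinations over the
  level sets (`JensenPoint.integral_smul_comp_eq_sum`);
* `JensenPoint.bU_boxKernel_mem` — every charged value lies in the convexity domain
  `{0 < ρ, ρσ³ < 11/10, ‖m‖² < 2ρE}` (two particles with distinct velocities per cube, strict
  Cauchy–Schwarz `Clausius.norm_bm_sq_lt`);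
* `JensenPoint.convexOn_relEnt` — `V ↦ h_σ(V | U)` is `η_σ` minus an affine map, convex by
  `HsFreeEnergyConvex`; conclude with `ConvexOn.map_sum_le`.
-/

noncomputable section

open MeasureTheory Filter Set Topology InformationTheory
open scoped ENNReal ContDiff Convolution

namespace Summit.AtomisticToContinuum.HydrodynamicLimit.Theorems.MacroClosureLine

open Literature.MathematicalPhysics.KineticTheory Literature.Analysis.FluidPDE
open Literature.Analysis.FunctionSpaces
open Summit.AtomisticToContinuum.HydrodynamicLimit.Theses

namespace Barycentric

namespace JensenPoint

variable {N : ℕ}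

/-- The block state as ONE weighted sum of the one-particle conserved vectors
`Wᵢ = (1, vᵢ, ‖vᵢ‖²/2)`: `Ū_φ(z, y) = (N+1)⁻¹ Σᵢ φ(xᵢ − y) • Wᵢ`. [folklore] -/
theorem bU_eq_sum (φ : T3 → ℝ) (z : Config (N + 1) (Fin 3) T3) (y : T3) :
    bU φ z y = ((N + 1 : ℕ) : ℝ)⁻¹ •
      ∑ i, φ ((z i).1 - y) • (((1 : ℝ), (z i).2, ‖(z i).2‖ ^ 2 / 2) : State) := by
  have hm : bm φ z y = ((N + 1 : ℕ) : ℝ)⁻¹ • ∑ i, φ ((z i).1 - y) • (z i).2 := by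
    simp only [bm, empiricalMomentumField]
    rw [integral_empiricalMeasure_V3]
  rw [bU, bρ_eq_sum, hm, bE_eq_sum]
  refine Prod.ext ?_ (Prod.ext ?_ ?_)
  · simp only [Prod.smul_fst, Prod.fst_sum, Prod.smul_mk, smul_eq_mul, mul_one]
  · simp only [Prod.smul_snd, Prod.smul_fst, Prod.snd_sum, Prod.fst_sum, Prod.smul_mk]
  · simp only [Prod.smul_snd, Prod.snd_sum, Prod.smul_mk, smul_eq_mul]

open Classical in
/-- Values of the box kernel. [folklore] -/
theorem boxKernel_apply (ℓ : ℝ) (y : T3) :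
    boxKernel ℓ y = if inCube ℓ y then (ℓ ^ 3)⁻¹ else 0 := by
  simp only [boxKernel, Set.indicator_apply, Set.mem_setOf_eq]

/-- The box kernel is non-negative. [folklore] -/
theorem boxKernel_nonneg {ℓ : ℝ} (hℓ : 0 < ℓ) (y : T3) : 0 ≤ boxKernel ℓ y :=
  Set.indicator_nonneg (fun _ _ => by positivity) _

/-- The box kernel is bounded by `ℓ⁻³`. [folklore] -/
theorem norm_boxKernel_le {ℓ : ℝ} (hℓ : 0 < ℓ) (y : T3) : ‖boxKernel ℓ y‖ ≤ (ℓ ^ 3)⁻¹ := by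
  rw [Real.norm_eq_abs, abs_of_nonneg (boxKernel_nonneg hℓ y), boxKernel_apply]
  split_ifs
  · exact le_rfl
  · positivity

/-- The cube `{repr y ∈ [0, ℓ)³}` is measurable. [folklore] -/
theorem measurableSet_inCube (ℓ : ℝ) : MeasurableSet {y : T3 | inCube ℓ y} := by
  have hml : ∀ l : Fin 3, Measurable fun y : T3 => Torus.repr y l := fun l =>
    measurable_subtype_coe.comp
      ((AddCircle.measurableEquivIco (1 : ℝ) 0).measurable.comp (measurable_pi_apply l))
  have : {y : T3 | inCube ℓ y} = ⋂ l : Fin 3, (fun y : T3 => Torus.repr y l) ⁻¹' Set.Iio ℓ := by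
    ext y
    simp [inCube]
  rw [this]
  exact MeasurableSet.iInter fun l => hml l measurableSet_Iio

/-- The box kernel is measurable. [folklore] -/
theorem measurable_boxKernel (ℓ : ℝ) : Measurable (boxKernel ℓ) :=
  measurable_const.indicator (measurableSet_inCube ℓ)

/-- The box block state is `(N+1)⁻¹ ℓ⁻³ Σ_{i ∈ cell} Wᵢ`. [folklore] -/
theorem bU_boxKernel (ℓ : ℝ) (z : Config (N + 1) (Fin 3) T3) (y : T3) :
    bU (boxKernel ℓ) z y = ((N + 1 : ℕ) : ℝ)⁻¹ •
      ∑ i ∈ cellSet ℓ z y, (ℓ ^ 3)⁻¹ • (((1 : ℝ), (z i).2, ‖(z i).2‖ ^ 2 / 2) : State) := by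
  rw [bU_eq_sum, cellSet, Finset.sum_filter]
  congr 1
  refine Finset.sum_congr rfl fun i _ => ?_
  by_cases h : inCube ℓ ((z i).1 - y)
  · rw [if_pos h, boxKernel_apply, if_pos h]
  · rw [if_neg h, boxKernel_apply, if_neg h, zero_smul]

/-- The box block density is `#cell / ((N+1) ℓ³)`. [folklore] -/
theorem bρ_boxKernel (ℓ : ℝ) (z : Config (N + 1) (Fin 3) T3) (y : T3) :
    bρ (boxKernel ℓ) z y = ((N + 1 : ℕ) : ℝ)⁻¹ * ((cellCount ℓ z y : ℝ) * (ℓ ^ 3)⁻¹) := by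
  have h := congrArg Prod.fst (bU_boxKernel ℓ z y)
  simpa only [bU, Prod.smul_fst, Prod.fst_sum, Prod.smul_mk, smul_eq_mul, mul_one,
    Finset.sum_const, nsmul_eq_mul, cellCount] using h

/-- **Domain**: every box block of a configuration with pairwise distinct velocities, at least two
particles per cube and sub-`11/10` packing per cube lies in the convexity domain
`{0 < ρ, ρσ³ < 11/10, ‖m‖² < 2ρE}`. [folklore] -/
theorem bU_boxKernel_mem {σ ℓ : ℝ} (hℓ : 0 < ℓ) (z : Config (N + 1) (Fin 3) T3)
    (hv : ∀ i j, i ≠ j → (z i).2 ≠ (z j).2) (h2 : ∀ y, 2 ≤ cellCount ℓ z y)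
    (hpack : ∀ y, (cellCount ℓ z y : ℝ) * σ ^ 3 < 11 / 10 * (((N : ℝ) + 1) * ℓ ^ 3)) (y : T3) :
    bU (boxKernel ℓ) z y ∈
      {U : State | 0 < U.1 ∧ U.1 * σ ^ 3 < 11 / 10 ∧ ‖U.2.1‖ ^ 2 < 2 * U.1 * U.2.2} := by
  have hb0 : ∀ y, 0 ≤ boxKernel ℓ y := boxKernel_nonneg hℓ
  have hpos : ∀ i ∈ cellSet ℓ z y, 0 < boxKernel ℓ ((z i).1 - y) := fun i hi => by
    have hi' : inCube ℓ ((z i).1 - y) := by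
      simp only [cellSet, Finset.mem_filter, Finset.mem_univ, true_and] at hi
      exact hi
    rw [boxKernel_apply, if_pos hi']
    positivity
  obtain ⟨a, ha, b, hb, hab⟩ := Finset.one_lt_card.1 (lt_of_lt_of_le one_lt_two (h2 y))
  have hn : (2 : ℝ) ≤ (cellCount ℓ z y : ℝ) := by exact_mod_cast h2 y
  have hN : (0 : ℝ) < ((N + 1 : ℕ) : ℝ) := by positivity
  refine ⟨?_, ?_, ?_⟩
  · show 0 < bρ (boxKernel ℓ) z y
    rw [bρ_boxKernel]
    exact mul_pos (inv_pos.2 hN) (mul_pos (by linarith) (by positivity))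
  · show bρ (boxKernel ℓ) z y * σ ^ 3 < 11 / 10
    rw [bρ_boxKernel]
    have hA : (0 : ℝ) < ((N : ℝ) + 1) * ℓ ^ 3 := by positivity
    have e : ((N + 1 : ℕ) : ℝ)⁻¹ * ((cellCount ℓ z y : ℝ) * (ℓ ^ 3)⁻¹) * σ ^ 3 =
        (cellCount ℓ z y : ℝ) * σ ^ 3 / (((N : ℝ) + 1) * ℓ ^ 3) := by
      push_cast
      field_simp
    rw [e, div_lt_iff₀ hA]
    exact hpack y
  · exact Clausius.norm_bm_sq_lt hb0 z y (hpos a ha) (hpos b hb) (hv a b hab)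

/-- The level sets of the cell index set of the shifted cube are measurable. [folklore] -/
theorem measurableSet_cellSet_eq (ℓ : ℝ) (z : Config (N + 1) (Fin 3) T3) (x : T3)
    (T : Finset (Fin (N + 1))) : MeasurableSet {w : T3 | cellSet ℓ z (x + w) = T} := by
  have hA : ∀ i, MeasurableSet {w : T3 | inCube ℓ ((z i).1 - (x + w))} := fun i =>
    measurableSet_preimage
      ((continuous_const.sub (continuous_const.add continuous_id)).measurable)
      (measurableSet_inCube ℓ)
  have : {w : T3 | cellSet ℓ z (x + w) = T} =
      ⋂ i, {w | inCube ℓ ((z i).1 - (x + w)) ↔ i ∈ T} := by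
    ext w
    simp only [Set.mem_setOf_eq, Set.mem_iInter, cellSet, Finset.ext_iff, Finset.mem_filter,
      Finset.mem_univ, true_and]
  rw [this]
  refine MeasurableSet.iInter fun i => ?_
  by_cases hi : i ∈ T
  · have e : {w : T3 | (inCube ℓ ((z i).1 - (x + w)) ↔ i ∈ T)} =
        {w | inCube ℓ ((z i).1 - (x + w))} := by
      ext w; simp only [Set.mem_setOf_eq, hi, iff_true]
    rw [e]; exact hA i
  · have e : {w : T3 | (inCube ℓ ((z i).1 - (x + w)) ↔ i ∈ T)} =
        {w | inCube ℓ ((z i).1 - (x + w))}ᶜ := by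
      ext w; simp only [Set.mem_setOf_eq, hi, iff_false, Set.mem_compl_iff]
    rw [e]; exact (hA i).compl

/-- **Finite-range disintegration**: if `S : 𝕋³ → P` takes finitely many values on measurable level
sets and `ψ` is integrable, then `∫ ψ(w) • g(S w) dw = Σ_T (∫_{S = T} ψ) • g T`. [folklore] -/
theorem integral_smul_comp_eq_sum {P : Type*} [Fintype P] [DecidableEq P] {E : Type*}
    [NormedAddCommGroup E] [NormedSpace ℝ E] [CompleteSpace E] (S : T3 → P)
    (hS : ∀ T, MeasurableSet {w | S w = T}) {ψ : T3 → ℝ} (hψ : Integrable ψ) (g : P → E) :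
    ∫ w, ψ w • g (S w) = ∑ T, (∫ w, {w | S w = T}.indicator ψ w) • g T := by
  have hpt : (fun w => ψ w • g (S w)) = fun w => ∑ T, ({w' | S w' = T}.indicator ψ w) • g T := by
    funext w
    rw [Finset.sum_eq_single_of_mem (S w) (Finset.mem_univ _)]
    · rw [Set.indicator_of_mem (by simp)]
    · intro T _ hT
      rw [Set.indicator_of_notMem (by simpa [eq_comm] using hT), zero_smul]
  rw [hpt, integral_finsetSum _ fun T _ => ((hψ.indicator (hS T)).smul_const (g T))]
  simp_rw [integral_smul_const]

/-- **Representation**: the block state of the mollified box kernel is the `ψ`-average of the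
shifted box block states, `Ū_{b ⋆ ψ}(z, x) = ∫ ψ(w) • Ū_b(z, x + w) dw`. [folklore] -/
theorem bU_conv_eq_integral {ℓ δ : ℝ} (hℓ : 0 < ℓ) (hδ : 0 < δ) (hδ4 : δ ≤ 1 / 4)
    (z : Config (N + 1) (Fin 3) T3) (x : T3) :
    bU (boxKernel ℓ ⋆ Torus.kernel (d := Fin 3) δ) z x =
      ∫ w, Torus.kernel (d := Fin 3) δ w • bU (boxKernel ℓ) z (x + w) := by
  have hψc : Continuous (Torus.kernel (d := Fin 3) δ) := Torus.continuous_kernel hδ hδ4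
  have hψi : Integrable (Torus.kernel (d := Fin 3) δ) := hψc.integrable_unitAddTorus
  have hint : ∀ i, Integrable fun w =>
      Torus.kernel (d := Fin 3) δ w * boxKernel ℓ ((z i).1 - (x + w)) := fun i =>
    hψi.mul_bdd
      ((measurable_boxKernel ℓ).comp
        ((continuous_const.sub (continuous_const.add continuous_id)).measurable)).aestronglyMeasurable
      (Eventually.of_forall fun w => norm_boxKernel_le hℓ _)
  have hconv : ∀ y, (boxKernel ℓ ⋆ Torus.kernel (d := Fin 3) δ) y =
      ∫ w, Torus.kernel (d := Fin 3) δ w * boxKernel ℓ (y - w) := fun y => by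
    rw [Torus.convolution_comm_real, convolution_lsmul]
    rfl
  simp_rw [bU_eq_sum]
  have hpt : ∀ w, Torus.kernel (d := Fin 3) δ w • (((N + 1 : ℕ) : ℝ)⁻¹ •
      ∑ i, boxKernel ℓ ((z i).1 - (x + w)) • (((1 : ℝ), (z i).2, ‖(z i).2‖ ^ 2 / 2) : State)) =
      ((N + 1 : ℕ) : ℝ)⁻¹ • ∑ i, (Torus.kernel (d := Fin 3) δ w * boxKernel ℓ ((z i).1 - (x + w))) •
        (((1 : ℝ), (z i).2, ‖(z i).2‖ ^ 2 / 2) : State) := by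
    intro w
    rw [smul_comm, Finset.smul_sum]
    simp_rw [smul_smul]
  simp_rw [hpt]
  rw [integral_smul, integral_finsetSum _ fun i _ => (hint i).smul_const _]
  simp_rw [integral_smul_const, hconv, sub_sub]

/-- **Convexity of the Bregman density** `V ↦ h_σ(V | U)` on the convexity domain of `η_σ`
(`η_σ` minus an affine function). [folklore] -/
theorem convexOn_relEnt (hH : StiffCollisionalRelaxation.HsFreeEnergyConvex) {σ : ℝ} (hσ : 0 < σ)
    (U : State) :
    ConvexOn ℝ {V : State | 0 < V.1 ∧ V.1 * σ ^ 3 < 11 / 10 ∧ ‖V.2.1‖ ^ 2 < 2 * V.1 * V.2.2}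
      (fun V => relEnt σ V U) := by
  have hη : ConvexOn ℝ {V : State | 0 < V.1 ∧ V.1 * σ ^ 3 < 11 / 10 ∧ ‖V.2.1‖ ^ 2 < 2 * V.1 * V.2.2}
      (hsEntropy σ) := hH σ hσ
  have hK := hη.1
  have haff : ConcaveOn ℝ {V : State | 0 < V.1 ∧ V.1 * σ ^ 3 < 11 / 10 ∧ ‖V.2.1‖ ^ 2 < 2 * V.1 * V.2.2}
      (fun V => hsEntropy σ U + fderiv ℝ (hsEntropy σ) U (V - U)) := by
    have h1 := ((fderiv ℝ (hsEntropy σ) U : State →L[ℝ] ℝ) : State →ₗ[ℝ] ℝ).concaveOn hK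
    have h2 := concaveOn_const (𝕜 := ℝ) (hsEntropy σ U - fderiv ℝ (hsEntropy σ) U U) hK
    have hfun : (fun V : State => hsEntropy σ U + fderiv ℝ (hsEntropy σ) U (V - U)) =
        (((fderiv ℝ (hsEntropy σ) U : State →L[ℝ] ℝ) : State →ₗ[ℝ] ℝ) : State → ℝ) +
          fun _ => hsEntropy σ U - fderiv ℝ (hsEntropy σ) U U := by
      funext V
      simp only [Pi.add_apply, ContinuousLinearMap.coe_coe, map_sub]
      ring
    rw [hfun]
    exact h1.add h2
  have hfun : (fun V => relEnt σ V U) =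
      hsEntropy σ - fun V => hsEntropy σ U + fderiv ℝ (hsEntropy σ) U (V - U) := by
    funext V
    simp only [Pi.sub_apply, relEnt]
    ring
  rw [hfun]
  exact hη.sub haff

end JensenPoint

open JensenPoint in
/-- **Pointwise Jensen for the box-smoothed block** (registered stub `stub_twoScale_jensenPoint`):
for the box kernel of side `ℓ ∈ (0,1]` mollified by `Torus.kernel δ`, `δ ∈ (0,1/4]`, a configuration with
pairwise distinct velocities, at least two particles and packing `< 11/10` in every cube of side `ℓ`, and any
homogeneous reference state, `h_σ⁺(Ū_{b⋆ψ}(z,x) | U_c) ≤ ∫ ψ(w) h_σ⁺(Ū_b(z,x+w) | U_c) dw`, by finite-range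
Jensen over the level sets of the cell index set `w ↦ cellSet ℓ z (x + w)`. [folklore] -/
theorem stub_twoScale_jensenPoint : StiffCollisionalRelaxation.HsFreeEnergyConvex → ∀ (σ : ℝ), 0 < σ →
    ∀ (uc : V3) (θc : ℝ) (N : ℕ) (ℓ δ : ℝ), 0 < ℓ → ℓ ≤ 1 → 0 < δ → δ ≤ 1 / 4 →
    ∀ (z : Config (N + 1) (Fin 3) T3), (∀ i j, i ≠ j → (z i).2 ≠ (z j).2) →
    (∀ y, 2 ≤ cellCount ℓ z y) →
    (∀ y, (cellCount ℓ z y : ℝ) * σ ^ 3 < 11 / 10 * (((N : ℝ) + 1) * ℓ ^ 3)) →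
    ∀ x : T3, max 0 (relEnt σ (bU (boxKernel ℓ ⋆ Torus.kernel (d := Fin 3) δ) z x) (stateOf 1 uc θc)) ≤
      ∫ w, Torus.kernel (d := Fin 3) δ w * max 0 (relEnt σ (bU (boxKernel ℓ) z (x + w)) (stateOf 1 uc θc)) := by
  intro hH σ hσ uc θc N ℓ δ hℓ _hℓ1 hδ hδ4 z hv h2 hpack x
  have hconv := convexOn_relEnt hH hσ (stateOf 1 uc θc)
  set S : T3 → Finset (Fin (N + 1)) := fun w => cellSet ℓ z (x + w) with hS_def
  set F : Finset (Fin (N + 1)) → State := fun T => ((N + 1 : ℕ) : ℝ)⁻¹ •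
    ∑ i ∈ T, (ℓ ^ 3)⁻¹ • (((1 : ℝ), (z i).2, ‖(z i).2‖ ^ 2 / 2) : State) with hF_def
  have hbF : ∀ w, bU (boxKernel ℓ) z (x + w) = F (S w) := fun w => bU_boxKernel ℓ z (x + w)
  have hSm : ∀ T, MeasurableSet {w | S w = T} := fun T => measurableSet_cellSet_eq ℓ z x T
  have hψi : Integrable (Torus.kernel (d := Fin 3) δ) :=
    (Torus.continuous_kernel hδ hδ4).integrable_unitAddTorus
  have hψ0 : ∀ w, 0 ≤ Torus.kernel (d := Fin 3) δ w := Torus.kernel_nonneg hδ.le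
  set lam : Finset (Fin (N + 1)) → ℝ := fun T =>
    ∫ w, {w | S w = T}.indicator (Torus.kernel (d := Fin 3) δ) w with hlam_def
  have hlam0 : ∀ T, 0 ≤ lam T := fun T =>
    integral_nonneg fun w => Set.indicator_nonneg (fun w _ => hψ0 w) _
  have hlam1 : ∑ T, lam T = 1 := by
    have h := integral_smul_comp_eq_sum S hSm hψi (fun _ => (1 : ℝ))
    simp only [smul_eq_mul, mul_one] at h
    rw [← h]
    exact Torus.integral_kernel hδ hδ4
  have hlamS : ∀ T, lam T ≠ 0 → ∃ w, S w = T := by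
    intro T hT
    by_contra hcon
    push Not at hcon
    apply hT
    have he : {w | S w = T} = ∅ := Set.eq_empty_iff_forall_notMem.2 hcon
    simp [hlam_def, he]
  have hdom : ∀ w, F (S w) ∈
      {U : State | 0 < U.1 ∧ U.1 * σ ^ 3 < 11 / 10 ∧ ‖U.2.1‖ ^ 2 < 2 * U.1 * U.2.2} :=
    fun w => (hbF w) ▸ bU_boxKernel_mem hℓ z hv h2 hpack (x + w)
  have hrep : bU (boxKernel ℓ ⋆ Torus.kernel (d := Fin 3) δ) z x = ∑ T, lam T • F T := by
    rw [bU_conv_eq_integral hℓ hδ hδ4 z x]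
    simp_rw [hbF]
    exact integral_smul_comp_eq_sum S hSm hψi F
  have hrhs : ∫ w, Torus.kernel (d := Fin 3) δ w *
      max 0 (relEnt σ (bU (boxKernel ℓ) z (x + w)) (stateOf 1 uc θc)) =
      ∑ T, lam T * max 0 (relEnt σ (F T) (stateOf 1 uc θc)) := by
    simp_rw [hbF]
    have h := integral_smul_comp_eq_sum S hSm hψi (fun T => max 0 (relEnt σ (F T) (stateOf 1 uc θc)))
    simpa only [smul_eq_mul] using h
  rw [hrep, hrhs]
  -- Jensen over the charged level sets
  set t : Finset (Finset (Fin (N + 1))) := Finset.univ.filter (fun T => lam T ≠ 0) with ht_def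
  have hsum_t : ∀ {M : Type} [AddCommGroup M] [Module ℝ M] (g : Finset (Fin (N + 1)) → M),
      ∑ T ∈ t, lam T • g T = ∑ T, lam T • g T := by
    intro M _ _ g
    refine Finset.sum_filter_of_ne fun T _ hne => ?_
    intro h0
    apply hne
    rw [h0, zero_smul]
  have h1t : ∑ T ∈ t, lam T = 1 := by
    rw [Finset.sum_filter_ne_zero, hlam1]
  have hmem : ∀ T ∈ t, F T ∈
      {U : State | 0 < U.1 ∧ U.1 * σ ^ 3 < 11 / 10 ∧ ‖U.2.1‖ ^ 2 < 2 * U.1 * U.2.2} := by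
    intro T hT
    obtain ⟨w, hw⟩ := hlamS T (Finset.mem_filter.1 hT).2
    rw [← hw]
    exact hdom w
  have hJ : relEnt σ (∑ T ∈ t, lam T • F T) (stateOf 1 uc θc) ≤
      ∑ T ∈ t, lam T • relEnt σ (F T) (stateOf 1 uc θc) :=
    hconv.map_sum_le (fun T _ => hlam0 T) h1t hmem
  rw [hsum_t, hsum_t] at hJ
  refine max_le (Finset.sum_nonneg fun T _ => mul_nonneg (hlam0 T) (le_max_left _ _)) ?_
  refine hJ.trans (Finset.sum_le_sum fun T _ => ?_)
  rw [smul_eq_mul]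
  exact mul_le_mul_of_nonneg_left (le_max_right _ _) (hlam0 T)

end Barycentric

end Summit.AtomisticToContinuum.HydrodynamicLimit.Theorems.MacroClosureLine

end
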